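/-
Copyright (c) 2026 the pub-hodgecm-mathlib formalisation cell (harness21).  Prover seat hodgecm-mathlib-K2Liu-p25 (g0), Track B «K2-LIT»,
#184♮ = hLiu418 = `stmt-HodgeConjecture-24832`; LEAD F0P6-plan (g14) BATCH #47 (4) ∕ desk K2Liu-p05 (g6) 15:20:10Z «(a) =»: the (L) face of the
#42F′ TOP adapter F-T1-hol (SIGS-RoadI-v3 §2 U5, RULING «M-157q»), third file of the `p25` lineage (★ p861157 `K2LiuResidueMapHolType`, ★ p861191
`K2LiuResidueMapKType`).  THEOREMS ONLY (no `def`, no `instance`, no notation, no named-fact hypothesis, no `sorry`); generated by `K2/K2Liu-p25/g0/gen/gen_lie.py`.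
-/
import Summits.HodgeConjecture.HodgeConjecture.Theorems.K2LiuResidueLieDerivativeStandard   -- ★ G1-END `hasDerivAt_resGen_stdExtension_orbit_half`
import HarnessLib

/-!
# Crux `HLiu418`, Road I v3, unit U5, adapter F-T1-hol — THE (L) FACE: the G1 clause of ★ G-2 for the residue form of a standard family,
# from section-level Lie data BY VALUE

Cell `hodgecm-mathlib`, crux item hLiu418 = `stmt-HodgeConjecture-24832` (helper lane `--supports`, count-neutral).  ★ G-2
`K2LiuHolDescendAdelic.exists_holDescend_adelic` (consumed through ★ p861157 `holType_of_descent` ∕ `hP₁_of_generators`) takes, for `F : H(𝔸) → ℂ`, the G1 clause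
(L) = `(DF, hL, hLc, hLl)`: a family `DF X : H(𝔸) → ℂ`, `X ∈ 𝔲 = archSkew`, with `HasDerivAt (t ↦ F (h · archExp hX t)) (DF X (h · archExp hX t)) t`, continuous,
ℝ-linear in `X`.  HERE `F := resGen hex` is the canonical residue form of the standard family `stdExtension 𝒦 ½ φ` (★ U0 `resGen`, socket #41's clauses BY VALUE
as `hex`), and (L) is DERIVED from SECTION-LEVEL data BY VALUE — for every `X ∈ 𝔲`: the Lie derivative `Xφ X` of `φ` along `archExp hX` (`hXφ`, continuous `hXφc`,
ℝ-LINEAR in `X`: `hXφl` — for Siegel–Weil sections `Xφ X = f_{ω(X)Φ}`, W4's section identity), the height log-derivative `H X` (`hH`, `hHc`; ★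
`K2LiuIwasawaHeightDerivContinuous.exists_heightDeriv_continuous_of_isStd`), and socket #41's bundles `hex₁ X` ∕ `hex₂ X` for `stdExt (Xφ X)` ∕ `stdExt (H X · φ)`:
* §1 **`resGen_lieDeriv_linear`** — `resGen (hex₁ (c•X+X′)) h = c · resGen (hex₁ X) h + resGen (hex₁ X′) h`: the derived family of `c•X+X′` IS `c • stdExt (Xφ X) + stdExt (Xφ X′)`
  pointwise (`hXφl`), so ★ U0.4 `resNorm_finset_sum` (`Fin 2`, coefficients `![c, 1]`) on the chosen continuations (★ `exists_continuation_resGen`) gives the identity;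
  section hypotheses from ★ `isSiegelDeltaSection_lieDeriv` ∕ `isSiegelDeltaSection_stdExtension` ∕ `continuous_stdExtension`;
* §2 **`exists_lieClause_resGen`** — THE (L) BINDERS OF ★ G-2 VERBATIM for `F := resGen hex`: `∃ DF, hL ∧ hLc ∧ hLl` with `DF X := resGen (hex₁ X)` on `𝔲` (and `0` off `𝔲`):
  `hL` = ★ G1-END `hasDerivAt_resGen_stdExtension_orbit_half` per `X`, `hLc` = ★ `continuous_resGen`, `hLl` = §1.
NOT HERE (SIGS §2 U5): the section-level producers (`Xφ` for #42F′'s twisted Siegel–Weil generator through W4 ★ `hasDerivAt_swSection_tmul_placeSecJ_expMem` + the curve identity;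
#41 applied to the derived families through their `K`-finiteness) and the (CR) face.
References: [MoeglinWaldspurger1995, IV.1.9–IV.1.11]; [KudlaRallis1994, §1 Thm. 1.1]; [Liu2021, App. B Lem. B.12 pp. 103–104]; [BorelJacquet1979, §4.1]; [Shimura1997, §§5–6];
[Knapp2002, 0.§2 Prop. 0.11].
HONEST LABEL: HC_CM is proved only modulo the 7 printed citations (2 remaining named inputs: hLiu418 = stmt-HodgeConjecture-24832,
h413 = stmt-HodgeConjecture-24833) until rung 0 closes; count-neutral helper, closes no socket.
-/

set_option autoImplicit false
set_option linter.dupNamespace false -- the mandated namespace repeats `HodgeConjecture.HodgeConjecture`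
set_option Elab.async false

noncomputable section

open scoped Matrix Topology BigOperators Classical
open Filter NumberField NumberField.mixedEmbedding NumberField.InfinitePlace IsDedekindDomain
open Literature.NumberTheory.Automorphic Literature.NumberTheory.Automorphic.UnitaryGroup Literature.NumberTheory.GaloisRepresentations
open Literature.NumberTheory.GelbartRogawski1991 Literature.NumberTheory.GelbartRogawski1991.GRConstruction
open Literature.NumberTheory.K2Lit.SiegelDoubled
open Summit.HodgeConjecture.HodgeConjecture.Cruxes.HLiu418.K2LiuFirstTermResidueFormDefs
open Summit.HodgeConjecture.HodgeConjecture.Cruxes.HLiu418.K2LiuFirstTermResidueForm (resNorm_finset_sum)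
open Summit.HodgeConjecture.HodgeConjecture.Cruxes.HLiu418.K2LiuFirstTermResidueGenDefs
open Summit.HodgeConjecture.HodgeConjecture.Cruxes.HLiu418.K2LiuArchOneParameterOrbitDefs (archExp)
open Summit.HodgeConjecture.HodgeConjecture.Cruxes.HLiu418.K2LiuFlatSectionLieDerivative (isSiegelDeltaSection_lieDeriv)
open Summit.HodgeConjecture.HodgeConjecture.Cruxes.HLiu418.K2LiuIwasawaDeltaUnimodular (IwasawaDatum.modDelta_eq_one_of_mem)
open Summit.HodgeConjecture.HodgeConjecture.Cruxes.HLiu418.K2LiuSiegelWeilSectionContinuous (continuous_stdExtension)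
open Summit.HodgeConjecture.HodgeConjecture.Cruxes.HLiu418.K2LiuResidueLieDerivativeStandard (hasDerivAt_resGen_stdExtension_orbit_half)

namespace Summit.HodgeConjecture.HodgeConjecture.Cruxes.HLiu418.K2LiuResidueMapLieType

variable (L : Type) [Field L] [NumberField L] [IsCMField L]
variable {N M n : ℕ} (e : Fin N × Fin M ≃ Fin n)
  (dV : Fin N → L) (hdV : ∀ i, IsCMField.complexConj L (dV i) = dV i) (hdV0 : ∀ i, dV i ≠ 0)
  (dW : Fin M → L) (hdW : ∀ i, IsCMField.complexConj L (dW i) = dW i) (hdW0 : ∀ i, dW i ≠ 0)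
  (𝒦 : IwasawaDatum L e dV hdV dW hdW)

/-! ## §1 The residue form of the derived family is ℝ-linear in `X` -/

include hdV0 hdW0 in
/-- **LINEARITY IN THE LIE ELEMENT.**  `χ` unitary, `𝒦` an Iwasawa datum (Δ-unimodular by ★ `modDelta_eq_one_of_mem`), `φ ∈ I(½, χ)`; Lie derivatives `Xφ X` of `φ` along
`archExp hX` for `X ∈ 𝔲` (`hXφ`), continuous (`hXφc`), ℝ-LINEAR in `X` (`hXφl`); socket #41's bundles `hex₁ X` for the derived standard families `stdExt ½ (Xφ X)` BY VALUE.
Then for `X, X′ ∈ 𝔲`, `c ∈ ℝ` and the membership witness `hXX′` of `c•X+X′`:  `resGen (hex₁ (c•X+X′) hXX′) h = c · resGen (hex₁ X hX) h + resGen (hex₁ X′ hX′) h`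
(★ U0.4 `resNorm_finset_sum` over `Fin 2` on the chosen continuations). [cite: KudlaRallis1994, §1 Thm. 1.1] [cite: MoeglinWaldspurger1995, IV.1.9–IV.1.11] -/
theorem resGen_lieDeriv_linear {χ : HeckeCharacter L} (hχ : χ.IsUnitary) {φ : HA L e dV hdV dW hdW → ℂ}
    (hφ : IsSiegelDeltaSection L e dV hdV dW hdW χ (1 / 2) φ)
    (Xφ : Matrix (Fin (n + n)) (Fin (n + n)) (mixedSpace L) → HA L e dV hdV dW hdW → ℂ)
    (hXφ : ∀ (X : Matrix (Fin (n + n)) (Fin (n + n)) (mixedSpace L)) (hX : X ∈ archSkew (Fp L) L (IsCMField.complexConj L) (n + n) (hermD L e dV hdV dW hdW)) (h : HA L e dV hdV dW hdW),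
      HasDerivAt (fun t : ℝ => φ (h * archExp (Fp L) L (IsCMField.complexConj L) (n + n) (hermD L e dV hdV dW hdW) hX t)) (Xφ X h) 0)
    (hXφc : ∀ X : Matrix (Fin (n + n)) (Fin (n + n)) (mixedSpace L), X ∈ archSkew (Fp L) L (IsCMField.complexConj L) (n + n) (hermD L e dV hdV dW hdW) → Continuous (Xφ X))
    (hXφl : ∀ (c : ℝ) (X X' : Matrix (Fin (n + n)) (Fin (n + n)) (mixedSpace L)), X ∈ archSkew (Fp L) L (IsCMField.complexConj L) (n + n) (hermD L e dV hdV dW hdW) → X' ∈ archSkew (Fp L) L (IsCMField.complexConj L) (n + n) (hermD L e dV hdV dW hdW) →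
      ∀ h, Xφ (c • X + X') h = (c : ℂ) * Xφ X h + Xφ X' h)
    (hex₁ : ∀ (X : Matrix (Fin (n + n)) (Fin (n + n)) (mixedSpace L)), X ∈ archSkew (Fp L) L (IsCMField.complexConj L) (n + n) (hermD L e dV hdV dW hdW) →
      (∃ (P : Finset ℂ) (Es : ℂ → HA L e dV hdV dW hdW → ℂ),
      (∀ h : HA L e dV hdV dW hdW, DifferentiableOn ℂ (fun s => Es s h) {s : ℂ | 0 < s.re}) ∧
      (∀ s : ℂ, 0 < s.re → Continuous (Es s)) ∧
      (∀ s : ℂ, 0 < s.re → ∀ (γ : ratH L e dV hdV dW hdW) (h : HA L e dV hdV dW hdW),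
        Es s ((γ : HA L e dV hdV dW hdW) * h) = Es s h) ∧
      (∀ (s : ℂ) (h : HA L e dV hdV dW hdW), (n : ℝ) / 2 < s.re →
        Es s h = (∏ p ∈ P, (s - p)) * eisensteinFamilyDelta L e dV hdV dW hdW (stdExtension 𝒦 (1 / 2) (Xφ X)) s h) ∧
      (∀ z : ℂ, 0 < z.re → ∃ C A r : ℝ, 0 < r ∧ ∀ s : ℂ, dist s z < r → ∀ h : HA L e dV hdV dW hdW,
        ‖Es s h‖ ≤ C * adelicHeightGL (n + n) L (h : GL (Fin (n + n)) (AdeleRing (𝓞 L) L)) ^ A)))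
    (c : ℝ) {X X' : Matrix (Fin (n + n)) (Fin (n + n)) (mixedSpace L)} (hX : X ∈ archSkew (Fp L) L (IsCMField.complexConj L) (n + n) (hermD L e dV hdV dW hdW)) (hX' : X' ∈ archSkew (Fp L) L (IsCMField.complexConj L) (n + n) (hermD L e dV hdV dW hdW)) (hXX' : c • X + X' ∈ archSkew (Fp L) L (IsCMField.complexConj L) (n + n) (hermD L e dV hdV dW hdW)) (h : HA L e dV hdV dW hdW) :
    resGen (hex₁ (c • X + X') hXX') h = (c : ℂ) * resGen (hex₁ X hX) h + resGen (hex₁ X' hX') h := by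
  have hK : 𝒦.IsDeltaUnimodular := IwasawaDatum.modDelta_eq_one_of_mem L e dV hdV hdV0 dW hdW hdW0 𝒦
  -- the chosen continuations (★ U0.2: `resGen` is their residue form)
  obtain ⟨P, Es, ⟨hd, -, -, hiv, -⟩, hres⟩ := exists_continuation_resGen (hex₁ (c • X + X') hXX')
  obtain ⟨P₁, E₁, ⟨hd₁, -, -, hiv₁, -⟩, hres₁⟩ := exists_continuation_resGen (hex₁ X hX)
  obtain ⟨P₂, E₂, ⟨hd₂, -, -, hiv₂, -⟩, hres₂⟩ := exists_continuation_resGen (hex₁ X' hX')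
  -- the derived family of `c•X+X′` is `c • stdExt (Xφ X) + stdExt (Xφ X′)`
  have hfam : stdExtension 𝒦 (1 / 2) (Xφ (c • X + X')) =
      ∑ j : Fin 2, (![(c : ℂ), 1] : Fin 2 → ℂ) j • (![stdExtension 𝒦 (1 / 2) (Xφ X), stdExtension 𝒦 (1 / 2) (Xφ X')] : Fin 2 → ℂ → HA L e dV hdV dW hdW → ℂ) j := by
    funext s y
    rw [Fin.sum_univ_two]
    simp only [Matrix.cons_val_zero, Matrix.cons_val_one, Pi.add_apply, Pi.smul_apply, smul_eq_mul, one_mul, stdExtension]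
    rw [hXφl c X X' hX hX' y]
    ring
  -- section hypotheses of the two derived families
  have hsec : ∀ (j : Fin 2) (s : ℂ), IsSiegelDeltaSection L e dV hdV dW hdW χ s
      ((![stdExtension 𝒦 (1 / 2) (Xφ X), stdExtension 𝒦 (1 / 2) (Xφ X')] : Fin 2 → ℂ → HA L e dV hdV dW hdW → ℂ) j s) := by
    intro j s
    fin_cases j
    · exact isSiegelDeltaSection_stdExtension hK (isSiegelDeltaSection_lieDeriv hX hφ (hXφ X hX)) s
    · exact isSiegelDeltaSection_stdExtension hK (isSiegelDeltaSection_lieDeriv hX' hφ (hXφ X' hX')) s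
  have hcont : ∀ (j : Fin 2) (s : ℂ), Continuous
      ((![stdExtension 𝒦 (1 / 2) (Xφ X), stdExtension 𝒦 (1 / 2) (Xφ X')] : Fin 2 → ℂ → HA L e dV hdV dW hdW → ℂ) j s) := by
    intro j s
    fin_cases j
    · exact continuous_stdExtension L e dV hdV hdV0 dW hdW hdW0 𝒦 (1 / 2) (hXφc X hX) s
    · exact continuous_stdExtension L e dV hdV hdV0 dW hdW hdW0 𝒦 (1 / 2) (hXφc X' hX') s
  -- ★ U0.4 on the three continuations
  have key := resNorm_finset_sum L e dV hdV hdV0 dW hdW hdW0 χ hχ (![(c : ℂ), 1])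
    (![stdExtension 𝒦 (1 / 2) (Xφ X), stdExtension 𝒦 (1 / 2) (Xφ X')]) hsec hcont _ hfam P Es hd hiv
    (![P₁, P₂]) (![E₁, E₂]) (fun j => by fin_cases j <;> assumption) (fun j => by fin_cases j <;> assumption)
  rw [hres, hres₁, hres₂, key]
  simp only [Fin.sum_univ_two, Matrix.cons_val_zero, Matrix.cons_val_one, one_mul]

/-! ## §2 The (L) binders of ★ G-2 for `F := resGen hex` -/

include hdV0 hdW0 in
/-- **THE (L) FACE OF F-T1-hol FOR THE RESIDUE FORM OF A STANDARD FAMILY.**  `0 < n`, `χ` unitary, `𝒦` an Iwasawa datum, `φ ∈ I(½, χ)` continuous; BY VALUE for every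
`X ∈ 𝔲 = archSkew`: Lie derivatives `Xφ X` (`hXφ`, `hXφc`, `hXφl`), height log-derivatives `H X` (`hH`, `hHc`), and socket #41's bundles `hex` (for `stdExt ½ φ`), `hex₁ X`
(for `stdExt ½ (Xφ X)`), `hex₂ X` (for `stdExt ½ (H X · φ)`).  THEN ★ G-2 `exists_holDescend_adelic`'s G1 clause holds for `F := resGen hex`:
`∃ DF, (∀ X hX h t, HasDerivAt (t ↦ F (h · archExp hX t)) (DF X (h · archExp hX t)) t) ∧ (∀ X ∈ 𝔲, Continuous (DF X)) ∧ (DF ℝ-linear in X on 𝔲)` — binders VERBATIM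
(`DF X := resGen (hex₁ X)` on `𝔲`; `hL` = ★ G1-END at `s₀ = ½`, where the height family's residue dies; `hLc` = ★ `continuous_resGen`; `hLl` = §1).
[cite: MoeglinWaldspurger1995, IV.1.9–IV.1.11] [cite: KudlaRallis1994, §1 Thm. 1.1] [cite: Liu2021, App. B Lem. B.12 pp. 103–104] [cite: BorelJacquet1979, §4.1] -/
theorem exists_lieClause_resGen (hn : 0 < n) {χ : HeckeCharacter L} (hχ : χ.IsUnitary) {φ : HA L e dV hdV dW hdW → ℂ}
    (hφ : IsSiegelDeltaSection L e dV hdV dW hdW χ (1 / 2) φ) (hφc : Continuous φ)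
    (Xφ : Matrix (Fin (n + n)) (Fin (n + n)) (mixedSpace L) → HA L e dV hdV dW hdW → ℂ)
    (hXφ : ∀ (X : Matrix (Fin (n + n)) (Fin (n + n)) (mixedSpace L)) (hX : X ∈ archSkew (Fp L) L (IsCMField.complexConj L) (n + n) (hermD L e dV hdV dW hdW)) (h : HA L e dV hdV dW hdW),
      HasDerivAt (fun t : ℝ => φ (h * archExp (Fp L) L (IsCMField.complexConj L) (n + n) (hermD L e dV hdV dW hdW) hX t)) (Xφ X h) 0)
    (hXφc : ∀ X : Matrix (Fin (n + n)) (Fin (n + n)) (mixedSpace L), X ∈ archSkew (Fp L) L (IsCMField.complexConj L) (n + n) (hermD L e dV hdV dW hdW) → Continuous (Xφ X))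
    (hXφl : ∀ (c : ℝ) (X X' : Matrix (Fin (n + n)) (Fin (n + n)) (mixedSpace L)), X ∈ archSkew (Fp L) L (IsCMField.complexConj L) (n + n) (hermD L e dV hdV dW hdW) → X' ∈ archSkew (Fp L) L (IsCMField.complexConj L) (n + n) (hermD L e dV hdV dW hdW) →
      ∀ h, Xφ (c • X + X') h = (c : ℂ) * Xφ X h + Xφ X' h)
    (H : Matrix (Fin (n + n)) (Fin (n + n)) (mixedSpace L) → HA L e dV hdV dW hdW → ℝ)
    (hH : ∀ (X : Matrix (Fin (n + n)) (Fin (n + n)) (mixedSpace L)) (hX : X ∈ archSkew (Fp L) L (IsCMField.complexConj L) (n + n) (hermD L e dV hdV dW hdW)) (h : HA L e dV hdV dW hdW),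
      HasDerivAt (fun t : ℝ => modDelta L e dV hdV dW hdW (𝒦.pPart (h * archExp (Fp L) L (IsCMField.complexConj L) (n + n) (hermD L e dV hdV dW hdW) hX t)))
        (modDelta L e dV hdV dW hdW (𝒦.pPart h) * H X h) 0)
    (hHc : ∀ X : Matrix (Fin (n + n)) (Fin (n + n)) (mixedSpace L), X ∈ archSkew (Fp L) L (IsCMField.complexConj L) (n + n) (hermD L e dV hdV dW hdW) → Continuous (H X))
    (hex : (∃ (P : Finset ℂ) (Es : ℂ → HA L e dV hdV dW hdW → ℂ),
      (∀ h : HA L e dV hdV dW hdW, DifferentiableOn ℂ (fun s => Es s h) {s : ℂ | 0 < s.re}) ∧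
      (∀ s : ℂ, 0 < s.re → Continuous (Es s)) ∧
      (∀ s : ℂ, 0 < s.re → ∀ (γ : ratH L e dV hdV dW hdW) (h : HA L e dV hdV dW hdW),
        Es s ((γ : HA L e dV hdV dW hdW) * h) = Es s h) ∧
      (∀ (s : ℂ) (h : HA L e dV hdV dW hdW), (n : ℝ) / 2 < s.re →
        Es s h = (∏ p ∈ P, (s - p)) * eisensteinFamilyDelta L e dV hdV dW hdW (stdExtension 𝒦 (1 / 2) φ) s h) ∧
      (∀ z : ℂ, 0 < z.re → ∃ C A r : ℝ, 0 < r ∧ ∀ s : ℂ, dist s z < r → ∀ h : HA L e dV hdV dW hdW,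
        ‖Es s h‖ ≤ C * adelicHeightGL (n + n) L (h : GL (Fin (n + n)) (AdeleRing (𝓞 L) L)) ^ A)))
    (hex₁ : ∀ (X : Matrix (Fin (n + n)) (Fin (n + n)) (mixedSpace L)), X ∈ archSkew (Fp L) L (IsCMField.complexConj L) (n + n) (hermD L e dV hdV dW hdW) →
      (∃ (P : Finset ℂ) (Es : ℂ → HA L e dV hdV dW hdW → ℂ),
      (∀ h : HA L e dV hdV dW hdW, DifferentiableOn ℂ (fun s => Es s h) {s : ℂ | 0 < s.re}) ∧
      (∀ s : ℂ, 0 < s.re → Continuous (Es s)) ∧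
      (∀ s : ℂ, 0 < s.re → ∀ (γ : ratH L e dV hdV dW hdW) (h : HA L e dV hdV dW hdW),
        Es s ((γ : HA L e dV hdV dW hdW) * h) = Es s h) ∧
      (∀ (s : ℂ) (h : HA L e dV hdV dW hdW), (n : ℝ) / 2 < s.re →
        Es s h = (∏ p ∈ P, (s - p)) * eisensteinFamilyDelta L e dV hdV dW hdW (stdExtension 𝒦 (1 / 2) (Xφ X)) s h) ∧
      (∀ z : ℂ, 0 < z.re → ∃ C A r : ℝ, 0 < r ∧ ∀ s : ℂ, dist s z < r → ∀ h : HA L e dV hdV dW hdW,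
        ‖Es s h‖ ≤ C * adelicHeightGL (n + n) L (h : GL (Fin (n + n)) (AdeleRing (𝓞 L) L)) ^ A)))
    (hex₂ : ∀ (X : Matrix (Fin (n + n)) (Fin (n + n)) (mixedSpace L)), X ∈ archSkew (Fp L) L (IsCMField.complexConj L) (n + n) (hermD L e dV hdV dW hdW) →
      (∃ (P : Finset ℂ) (Es : ℂ → HA L e dV hdV dW hdW → ℂ),
      (∀ h : HA L e dV hdV dW hdW, DifferentiableOn ℂ (fun s => Es s h) {s : ℂ | 0 < s.re}) ∧
      (∀ s : ℂ, 0 < s.re → Continuous (Es s)) ∧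
      (∀ s : ℂ, 0 < s.re → ∀ (γ : ratH L e dV hdV dW hdW) (h : HA L e dV hdV dW hdW),
        Es s ((γ : HA L e dV hdV dW hdW) * h) = Es s h) ∧
      (∀ (s : ℂ) (h : HA L e dV hdV dW hdW), (n : ℝ) / 2 < s.re →
        Es s h = (∏ p ∈ P, (s - p)) * eisensteinFamilyDelta L e dV hdV dW hdW (stdExtension 𝒦 (1 / 2) (fun y => (H X y : ℂ) * φ y)) s h) ∧
      (∀ z : ℂ, 0 < z.re → ∃ C A r : ℝ, 0 < r ∧ ∀ s : ℂ, dist s z < r → ∀ h : HA L e dV hdV dW hdW,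
        ‖Es s h‖ ≤ C * adelicHeightGL (n + n) L (h : GL (Fin (n + n)) (AdeleRing (𝓞 L) L)) ^ A))) :
    ∃ DF : Matrix (Fin (n + n)) (Fin (n + n)) (mixedSpace L) → HA L e dV hdV dW hdW → ℂ,
      (∀ (X : Matrix (Fin (n + n)) (Fin (n + n)) (mixedSpace L)) (hX : X ∈ archSkew (Fp L) L (IsCMField.complexConj L) (n + n) (hermD L e dV hdV dW hdW)) (h : HA L e dV hdV dW hdW) (t : ℝ),
        HasDerivAt (fun t : ℝ => resGen hex (h * archExp (Fp L) L (IsCMField.complexConj L) (n + n) (hermD L e dV hdV dW hdW) hX t : HA L e dV hdV dW hdW))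
          (DF X (h * archExp (Fp L) L (IsCMField.complexConj L) (n + n) (hermD L e dV hdV dW hdW) hX t : HA L e dV hdV dW hdW)) t) ∧
      (∀ X : Matrix (Fin (n + n)) (Fin (n + n)) (mixedSpace L), X ∈ archSkew (Fp L) L (IsCMField.complexConj L) (n + n) (hermD L e dV hdV dW hdW) → Continuous (DF X)) ∧
      (∀ (c : ℝ) (X X' : Matrix (Fin (n + n)) (Fin (n + n)) (mixedSpace L)), X ∈ archSkew (Fp L) L (IsCMField.complexConj L) (n + n) (hermD L e dV hdV dW hdW) → X' ∈ archSkew (Fp L) L (IsCMField.complexConj L) (n + n) (hermD L e dV hdV dW hdW) →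
        ∀ h, DF (c • X + X') h = (c : ℂ) * DF X h + DF X' h) := by
  -- `DF X := resGen (hex₁ X)` on `𝔲`, `0` off `𝔲` (no definition: an `∃` with its unfolding)
  obtain ⟨DF, hDF⟩ : ∃ DF : Matrix (Fin (n + n)) (Fin (n + n)) (mixedSpace L) → HA L e dV hdV dW hdW → ℂ,
      ∀ X, DF X = if hX : X ∈ archSkew (Fp L) L (IsCMField.complexConj L) (n + n) (hermD L e dV hdV dW hdW) then resGen (hex₁ X hX) else 0 := ⟨_, fun _ => rfl⟩
  have hDF' : ∀ (X : Matrix (Fin (n + n)) (Fin (n + n)) (mixedSpace L)) (hX : X ∈ archSkew (Fp L) L (IsCMField.complexConj L) (n + n) (hermD L e dV hdV dW hdW)), DF X = resGen (hex₁ X hX) := fun X hX => by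
    rw [hDF, dif_pos hX]
  refine ⟨DF, fun X hX h t => ?_, fun X hX => ?_, fun c X X' hX hX' h => ?_⟩
  · -- (hL): ★ G1-END at the centre
    rw [hDF' X hX]
    exact hasDerivAt_resGen_stdExtension_orbit_half L e dV hdV hdV0 dW hdW hdW0 𝒦 hX hn hχ hφ hφc (hXφ X hX) (hXφc X hX) (hH X hX) (hHc X hX)
      hex (hex₁ X hX) (hex₂ X hX) h t
  · -- (hLc): ★ U0.3a
    rw [hDF' X hX]
    exact continuous_resGen (hex₁ X hX)
  · -- (hLl): §1
    have hXX' : c • X + X' ∈ archSkew (Fp L) L (IsCMField.complexConj L) (n + n) (hermD L e dV hdV dW hdW) :=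
      (archSkew (Fp L) L (IsCMField.complexConj L) (n + n) (hermD L e dV hdV dW hdW)).add_mem ((archSkew (Fp L) L (IsCMField.complexConj L) (n + n) (hermD L e dV hdV dW hdW)).smul_mem c hX) hX'
    rw [hDF' _ hXX', hDF' X hX, hDF' X' hX']
    exact resGen_lieDeriv_linear L e dV hdV hdV0 dW hdW hdW0 𝒦 hχ hφ Xφ hXφ hXφc hXφl hex₁ c hX hX' hXX' h

end Summit.HodgeConjecture.HodgeConjecture.Cruxes.HLiu418.K2LiuResidueMapLieType

end
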